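/-
Copyright (c) 2026 the pub-hodgecm-mathlib formalisation cell (harness21).  Prover seat hodgecm-mathlib-LH4-p19 (g2), req620 Track A «(D-RAM) FOUR-FRAME» squad
(STAGE-1b, row (2) of the piece `f_{T₊}`, the (β₂) road (R-36) «PURE-CELL LEDGER»; β₂ sub-dealer LH4-p04 lineage, lane B (RamK), row (L-D♭) «the diagonal cell below the
clean line» — the COUNT, (T, V)-coordinates of the cell), 2026-09-04.
-/
import Summits.HodgeConjecture.HodgeConjecture.Theorems.F0P3cDyRamDiagonalCellScalarUnit      -- ★ p862573 (this seat): `v_inv_add_map_inv_eq`, `v_mul_add_map_mul_eq_one`, `normTheta_sub_map_eq_sq_add`, `v_add_map_eq_one_of_not_isOrd_div`; brings ★ DEFS `IsOrd ∕ dualGen ∕ glueUnit`, ★ `v_add_map_le_of_le`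
import Summits.HodgeConjecture.HodgeConjecture.Theorems.F0P3cDyRamDiagonalCellLiteralDigits   -- ★ (this seat, K2): `hatw_add_map_hatw` (`Tr_ρ ŵ(V) = 1`)
import HarnessLib

/-!
# Crux `H413`, line LH4 «(D-RAM) FOUR-FRAME» — STAGE-1b, row (2), the (β₂) road (R-36), lane B, row (L-D♭), THE COUNT — «THE (T, V)-COORDINATES OF THE DIAGONAL CELL»:
# for `Λ = x₀·𝒪_b ∈ D` the `Θ`-fixed unit `ŵ = (ν·κ)⁻¹` (`κ = h·N_Θ(x₀)`, `ν = (α − ρα)Θ(α − ρα)`) carries the glue unit (`r·c_U = −Tr_ρ ŵ` EXACTLY) and the letter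
# scalar (`Tr_ρ(μ∕D₀) = Â·T + B̂·W`, `T = Tr_ρ ŵ`, `W = Tr_ρ(θ₀ŵ)`, `μ∕P = Â + B̂θ₀`), and factors as `ŵ = T·ŵ(V)`, `V = W∕T`, `ŵ(V) = (V − ρθ₀)∕(θ₀ − ρθ₀)`

Cell `hodgecm-mathlib` (D-0151), FLOOR 0, crux item H413 = `stmt-HodgeConjecture-24833`, route of record `HCCMUnconditional`; squad F0∕P3c∕LH4; lane
`--supports stmt-HodgeConjecture-24833 --as helper` (count-neutral; pays NO tier-0 row).  THEOREMS ONLY (no `def`, no instance, no notation, no `sorry`, default heartbeats);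
★-only imports; states NO law; (β₂) stays a HYPOTHESIS.  DATUM-FREE one-field RamK letters (`M` with `ρ`, `Θ`, `α`; ★ DEFS `dualGen ∕ glueUnit ∕ IsOrd`); no lattice, no
residue field; the pivot `θ₀ := α·Θα` (§1) is built from the frame, no new binder.

WHY (memo `F0/P3c/LH4/LH4-p19/g0/MECH-LDflat.v1.LH4p19g0.md` 8f57960d §2; this seat's ★ p862554∕p862573 (per-vertex half) and ★ p862655 ∕ ★-cand K2 (digit counts)).  The
COUNT of (L-D♭) compares, over the diagonal cell `D`, the lattices that are POPULATED (glue unit a norm: `ω_σ(r) = 1`) and carry LABEL `+` (`ω_σ(f_Λ) = 1`, `s_Λ ≡ f_Λ·t₊`,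
`jE s_Λ = Tr_ρ(μ∕D₀)`, ★ p862554).  Both are functions of ONE `Θ`-fixed unit `ŵ(Λ) = (ν·κ)⁻¹`: THIS FILE supplies the exact dictionary and the coordinates in which the digit
counts ★ p862655 (E-side) and K2 (K♮-side) are stated.
* §1 `theta0_letters` — the pivot `θ₀ = α·Θα` is `Θ`-fixed, integral, and moved by `ρ` by a UNIT (`|α − ρα| = 1`, `|2| < 1`, the RamK case-definer `|α − Θα| < 1`):
  `𝒪_{K♮} = 𝒪_F ⊕ 𝒪_F·ρθ₀`.
* §2 `map_coordB`∕`map_coordA` — `ρ`-COORDINATES of any `z`: `B(z) = (z − ρz)∕(θ₀ − ρθ₀)`, `A(z) = z − B(z)·θ₀` are `ρ`-fixed, `z = A + B·θ₀`; `trace_mul_eq_coords`: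
  `Tr_ρ(z·w) = A(z)·Tr_ρ(w) + B(z)·Tr_ρ(θ₀w)`.
* §3 `map_traceT`∕`map_traceW` (`T = Tr_ρ ŵ`, `W = Tr_ρ(θ₀ŵ)` are doubly fixed for `Θ`-fixed `ŵ`), `eq_traceT_mul_hatw` (`ŵ = T·ŵ(W∕T)`), `traceW_hatw` (`Tr_ρ(θ₀·ŵ(V)) = V`),
  `hatw_mul_eq_hatw_iff` (`T·ŵ(V) = T′·ŵ(V′) ↔ T = T′ ∧ V = V′` for doubly… `ρ`-fixed data).
* §4 `glueUnit_mul_eq_neg_trace` — THE GLUE DICTIONARY: `glueUnit ρ Θ α (ϖE^b) h ϖE c_U x₀ b · c_U = −Tr_ρ ŵ` with `ŵ = (ν·h·N_Θ x₀)⁻¹` (`Y·ΘY = κ²·ν·P`, `P = (ϖE·ΘϖE)^b`).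
* §5 `scalar_div_eq_mul_hatw` (`μ∕D₀ = (μ∕P)·ŵ`, `D₀ = ϖE^b(α − ρα)·ΘY = P·ν·κ`), `trace_scalar_eq_coords` (`Tr_ρ(μ∕D₀) = Â·T + B̂·W`), `v_coordB_scalar` ∕ `v_coordA_scalar`
  (`|B̂| = |ϖE|^{2g}`, `|Â| = 1` from the EXACT gap `|μ − ρμ| = |ϖE^{2b+2g}(α − ρα)|`, `1 ≤ g`).
WHAT IS NOT CLAIMED: the E-side reading `ω_σ(f_Λ) = ω_σ(T̂)·ω_σ(α₁ + γ₁V)` (K4), the lattice fibration (K5), the assembly (K6).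
HONEST LABEL.  Count-neutral local algebra; nothing printed is asserted; no census law is stated; `HC_CM` is proved only modulo the 7 printed citations (2 remaining named inputs:
hLiu418 = `stmt-HodgeConjecture-24832`, h413 = `stmt-HodgeConjecture-24833`) until rung 0 closes.
## References
* [Jacobowitz1962] R. Jacobowitz, *Hermitian forms over local fields*, Amer. J. Math. 84 (1962): §4 (dual lattices, modular components, gluing).
* [Serre1979] J.-P. Serre, *Local Fields*, GTM 67 (1979): Ch. V §2 Prop. 3 (unramified: integral basis and trace), Ch. III §6 Prop. 12 (orders), Ch. V §3 Cor. 3.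
* [Flicker1998UnitaryFL] Y. Z. Flicker, *Elementary proof of the fundamental lemma for a unitary group*, Canad. J. Math. 50 (1998): Prop. 7 p. 84 (torus-orbit census, type RamK).
* [Kottwitz1986BaseChangeUnits] R. E. Kottwitz, *Base change for unit elements of Hecke algebras*, Compositio Math. 60 (1986): §1 pp. 240–241.
* [Rogawski1990] J. D. Rogawski, *Automorphic Representations of Unitary Groups in Three Variables*, Ann. of Math. Stud. 123 (1990): §4.9 Prop. 4.9.1 (b) p. 55, §12.2.
-/

set_option autoImplicit false

noncomputable section

namespace Summit.HodgeConjecture.HodgeConjecture.Cruxes.H413.F0P3cDyRamDiagonalCellCoordinates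

open scoped Valued WithZero
open WithZero
open Summit.HodgeConjecture.HodgeConjecture.Cruxes.H413.F0P3cDyRamToricCensusDefs
open Summit.HodgeConjecture.HodgeConjecture.Cruxes.H413.F0P3cDyRamDiagonalCellLetter (v_add_map_le_of_le)
open Summit.HodgeConjecture.HodgeConjecture.Cruxes.H413.F0P3cDyRamDiagonalCellScalarUnit (v_inv_add_map_inv_eq v_mul_add_map_mul_eq_one normTheta_sub_map_eq_sq_add
  v_add_map_eq_one_of_not_isOrd_div)
open Summit.HodgeConjecture.HodgeConjecture.Cruxes.H413.F0P3cDyRamDiagonalCellLiteralDigits (hatw_add_map_hatw)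

variable {K : Type} [Field K] [Valued K ℤᵐ⁰] {ρ Θ : K →+* K} {α : K}

/-! ## §1 The pivot `θ₀ = α·Θα` -/

/-- **THE PIVOT `θ₀ = α·Θα` IS `Θ`-FIXED, INTEGRAL AND MOVED BY `ρ` BY A UNIT.**  RamK letters: `ρ`, `Θ` commuting isometric involutions, `|α| ≤ 1`, `|α − ρα| = 1`, the
case-definer `|α − Θα| < 1`, and `|2| < 1` (wild place).  Then `Θ(αΘα) = αΘα`, `|αΘα| ≤ 1`, `|αΘα − ρ(αΘα)| = 1` (`αΘα − ρ(αΘα) = (α − ρα)(α + ρα) + [α(Θα − α) − ρα·ρ(Θα − α)]`,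
`|α + ρα| = |(α − ρα) + 2ρα| = 1`). [cite: Serre1979, Ch. V §2 Prop. 3] [cite: Flicker1998UnitaryFL, Prop. 7 p. 84] -/
theorem theta0_letters (hvρ : ∀ x, Valued.v (ρ x) = Valued.v x) (hΘΘ : ∀ x, Θ (Θ x) = x)
    (hvΘ : ∀ x, Valued.v (Θ x) = Valued.v x) (hα1 : Valued.v α ≤ 1) (hαρ1 : Valued.v (α - ρ α) = 1) (hram : Valued.v (α - Θ α) < 1)
    (h2 : Valued.v (2 : K) < 1) :
    Θ (α * Θ α) = α * Θ α ∧ Valued.v (α * Θ α) ≤ 1 ∧ Valued.v (α * Θ α - ρ (α * Θ α)) = 1 := by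
  refine ⟨by rw [map_mul, hΘΘ, mul_comm], by rw [Valuation.map_mul, hvΘ]; exact mul_le_one' hα1 hα1, ?_⟩
  have hsum : Valued.v (α + ρ α) = 1 := by
    have e : α + ρ α = (α - ρ α) + 2 * ρ α := by ring
    have hlt : Valued.v (2 * ρ α) < Valued.v (α - ρ α) := by
      rw [hαρ1, Valuation.map_mul, hvρ]
      calc Valued.v (2 : K) * Valued.v α ≤ Valued.v (2 : K) * 1 := by gcongr
        _ < 1 := by rw [mul_one]; exact h2
    rw [e, Valuation.map_add_eq_of_lt_left _ hlt, hαρ1]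
  have hmain : Valued.v ((α - ρ α) * (α + ρ α)) = 1 := by rw [Valuation.map_mul, hαρ1, hsum, one_mul]
  have e : α * Θ α - ρ (α * Θ α) = (α - ρ α) * (α + ρ α) + (α * (Θ α - α) + -(ρ α * ρ (Θ α - α))) := by
    rw [map_mul, map_sub]; ring
  have hsmall : Valued.v (α * (Θ α - α) + -(ρ α * ρ (Θ α - α))) < Valued.v ((α - ρ α) * (α + ρ α)) := by
    rw [hmain]
    have hΘα : Valued.v (Θ α - α) < 1 := by rw [← Valuation.map_neg, neg_sub]; exact hram
    refine lt_of_le_of_lt (Valuation.map_add _ _ _) (max_lt ?_ ?_)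
    · rw [Valuation.map_mul]
      calc Valued.v α * Valued.v (Θ α - α) ≤ 1 * Valued.v (Θ α - α) := by gcongr
        _ < 1 := by rw [one_mul]; exact hΘα
    · rw [Valuation.map_neg, Valuation.map_mul, hvρ, hvρ]
      calc Valued.v α * Valued.v (Θ α - α) ≤ 1 * Valued.v (Θ α - α) := by gcongr
        _ < 1 := by rw [one_mul]; exact hΘα
  rw [e, Valuation.map_add_eq_of_lt_left _ hsmall, hmain]

/-! ## §2 `ρ`-coordinates with respect to `θ₀` and the trace of a product -/

omit [Valued K ℤᵐ⁰] in
/-- **`ρ`-COORDINATES**: for `ρθ₀ ≠ θ₀` and any `z`, `B = (z − ρz)∕(θ₀ − ρθ₀)` and `A = z − B·θ₀` are `ρ`-fixed (so `z = A + B·θ₀` with coefficients in `Fix ρ`).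
[cite: Serre1979, Ch. V §2 Prop. 3] -/
theorem map_coordAB (hρρ : ∀ x, ρ (ρ x) = x) {θ₀ : K} (hθ₀ : ρ θ₀ ≠ θ₀) (z : K) :
    ρ ((z - ρ z) / (θ₀ - ρ θ₀)) = (z - ρ z) / (θ₀ - ρ θ₀) ∧ ρ (z - (z - ρ z) / (θ₀ - ρ θ₀) * θ₀) = z - (z - ρ z) / (θ₀ - ρ θ₀) * θ₀ := by
  have hδ : θ₀ - ρ θ₀ ≠ 0 := sub_ne_zero.2 (Ne.symm hθ₀)
  have hδ' : ρ θ₀ - θ₀ ≠ 0 := sub_ne_zero.2 hθ₀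
  have hB : ρ ((z - ρ z) / (θ₀ - ρ θ₀)) = (z - ρ z) / (θ₀ - ρ θ₀) := by
    rw [map_div₀, map_sub, map_sub, hρρ, hρρ, div_eq_div_iff hδ' hδ]; ring
  refine ⟨hB, ?_⟩
  rw [map_sub, map_mul, hB]
  have key : (z - ρ z) / (θ₀ - ρ θ₀) * (θ₀ - ρ θ₀) = z - ρ z := div_mul_cancel₀ _ hδ
  linear_combination key

omit [Valued K ℤᵐ⁰] in
/-- **THE TRACE OF A PRODUCT IN COORDINATES**: with `z = A + B·θ₀` (`A`, `B` `ρ`-fixed), `Tr_ρ(z·w) = A·Tr_ρ(w) + B·Tr_ρ(θ₀·w)` for every `w`. [cite: Serre1979, Ch. V §2 Prop. 3] -/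
theorem trace_mul_eq_coords {A B θ₀ w : K} (hρA : ρ A = A) (hρB : ρ B = B) :
    (A + B * θ₀) * w + ρ ((A + B * θ₀) * w) = A * (w + ρ w) + B * (θ₀ * w + ρ (θ₀ * w)) := by
  rw [map_mul, map_add, map_mul, hρA, hρB, map_mul]; ring

/-! ## §3 The doubly fixed coordinates `T = Tr_ρ ŵ`, `W = Tr_ρ(θ₀ŵ)` of a `Θ`-fixed `ŵ`, and the factorisation `ŵ = T·ŵ(W∕T)` -/

omit [Valued K ℤᵐ⁰] in
/-- **`T` AND `W` ARE DOUBLY FIXED**: for `Θ`-fixed `ŵ`, `θ₀` (`ρ`, `Θ` commuting, `ρρ = 1`), `T = ŵ + ρŵ` and `W = θ₀ŵ + ρ(θ₀ŵ)` are fixed by `ρ` and by `Θ`.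
[cite: Serre1979, Ch. V §2 Prop. 3] -/
theorem map_traceTW (hρρ : ∀ x, ρ (ρ x) = x) (hΘρ : ∀ x, Θ (ρ x) = ρ (Θ x)) {θ₀ ŵ : K} (hΘθ₀ : Θ θ₀ = θ₀) (hΘŵ : Θ ŵ = ŵ) :
    ρ (ŵ + ρ ŵ) = ŵ + ρ ŵ ∧ Θ (ŵ + ρ ŵ) = ŵ + ρ ŵ ∧ ρ (θ₀ * ŵ + ρ (θ₀ * ŵ)) = θ₀ * ŵ + ρ (θ₀ * ŵ) ∧ Θ (θ₀ * ŵ + ρ (θ₀ * ŵ)) = θ₀ * ŵ + ρ (θ₀ * ŵ) := by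
  refine ⟨by rw [map_add, hρρ, add_comm], by rw [map_add, hΘŵ, hΘρ, hΘŵ], by rw [map_add, hρρ, add_comm], ?_⟩
  rw [map_add, map_mul, hΘθ₀, hΘŵ, hΘρ, map_mul, hΘθ₀, hΘŵ]

omit [Valued K ℤᵐ⁰] in
/-- **THE FACTORISATION `ŵ = T·ŵ(W∕T)`**: with `T = ŵ + ρŵ ≠ 0`, `W = θ₀ŵ + ρ(θ₀ŵ)`, `ŵ(V) = (V − ρθ₀)∕(θ₀ − ρθ₀)`: `ŵ = T·ŵ(W∕T)` — indeed `ŵ·(θ₀ − ρθ₀) = W − T·ρθ₀`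
identically. [cite: Serre1979, Ch. V §2 Prop. 3] -/
theorem eq_traceT_mul_hatw {θ₀ : K} (hθ₀ : ρ θ₀ ≠ θ₀) {ŵ : K} (hT : ŵ + ρ ŵ ≠ 0) :
    ŵ = (ŵ + ρ ŵ) * (((θ₀ * ŵ + ρ (θ₀ * ŵ)) / (ŵ + ρ ŵ) - ρ θ₀) / (θ₀ - ρ θ₀)) := by
  have hδ : θ₀ - ρ θ₀ ≠ 0 := sub_ne_zero.2 (Ne.symm hθ₀)
  rw [map_mul]
  field_simp
  ring

omit [Valued K ℤᵐ⁰] in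
/-- **`Tr_ρ(θ₀·ŵ(V)) = V`** for `ρ`-fixed `V` (and `Tr_ρ ŵ(V) = 1`, ★ `hatw_add_map_hatw`): the coordinates of `T·ŵ(V)` are `(T, T·V)`. [cite: Serre1979, Ch. V §2 Prop. 3] -/
theorem traceW_hatw (hρρ : ∀ x, ρ (ρ x) = x) {θ₀ : K} (hθ₀ : ρ θ₀ ≠ θ₀) {V : K} (hρV : ρ V = V) :
    θ₀ * ((V - ρ θ₀) / (θ₀ - ρ θ₀)) + ρ (θ₀ * ((V - ρ θ₀) / (θ₀ - ρ θ₀))) = V := by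
  have hδ : θ₀ - ρ θ₀ ≠ 0 := sub_ne_zero.2 (Ne.symm hθ₀)
  have hδ' : ρ θ₀ - θ₀ ≠ 0 := sub_ne_zero.2 hθ₀
  rw [map_mul, map_div₀, map_sub, map_sub, hρρ, hρV]
  field_simp
  ring

omit [Valued K ℤᵐ⁰] in
/-- **COORDINATES DETERMINE THE POINT**: for `ρ`-fixed `T, T′, V, V′` with `T·ŵ(V) = T′·ŵ(V′)`, `T = T′` (take `Tr_ρ`) and then `V = V′` (take `Tr_ρ(θ₀·)`), provided `T ≠ 0`.
[cite: Serre1979, Ch. V §2 Prop. 3] -/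
theorem eq_of_traceT_mul_hatw_eq (hρρ : ∀ x, ρ (ρ x) = x) {θ₀ : K} (hθ₀ : ρ θ₀ ≠ θ₀) {T T' V V' : K} (hρT : ρ T = T) (hρT' : ρ T' = T')
    (hρV : ρ V = V) (hρV' : ρ V' = V') (hT0 : T ≠ 0)
    (h : T * ((V - ρ θ₀) / (θ₀ - ρ θ₀)) = T' * ((V' - ρ θ₀) / (θ₀ - ρ θ₀))) : T = T' ∧ V = V' := by
  have h1 := hatw_add_map_hatw (θ₀ := θ₀) hρρ hθ₀ hρV
  have h1' := hatw_add_map_hatw (θ₀ := θ₀) hρρ hθ₀ hρV'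
  have hT : T = T' := by
    have e : T * ((V - ρ θ₀) / (θ₀ - ρ θ₀)) + ρ (T * ((V - ρ θ₀) / (θ₀ - ρ θ₀))) =
        T' * ((V' - ρ θ₀) / (θ₀ - ρ θ₀)) + ρ (T' * ((V' - ρ θ₀) / (θ₀ - ρ θ₀))) := by rw [h]
    rw [map_mul, map_mul, hρT, hρT'] at e
    have e2 : T * ((V - ρ θ₀) / (θ₀ - ρ θ₀) + ρ ((V - ρ θ₀) / (θ₀ - ρ θ₀))) = T' * ((V' - ρ θ₀) / (θ₀ - ρ θ₀) + ρ ((V' - ρ θ₀) / (θ₀ - ρ θ₀))) := by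
      linear_combination e
    rwa [h1, h1', mul_one, mul_one] at e2
  refine ⟨hT, ?_⟩
  have h2 := traceW_hatw (θ₀ := θ₀) hρρ hθ₀ hρV
  have h2' := traceW_hatw (θ₀ := θ₀) hρρ hθ₀ hρV'
  rw [← hT] at h
  have h3 := mul_left_cancel₀ hT0 h
  have e : θ₀ * ((V - ρ θ₀) / (θ₀ - ρ θ₀)) + ρ (θ₀ * ((V - ρ θ₀) / (θ₀ - ρ θ₀))) = θ₀ * ((V' - ρ θ₀) / (θ₀ - ρ θ₀)) + ρ (θ₀ * ((V' - ρ θ₀) / (θ₀ - ρ θ₀))) := by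
    rw [h3]
  rwa [h2, h2'] at e

/-! ## §4 The glue dictionary: `r·c_U = −Tr_ρ ŵ` exactly -/

section Glue

variable {ϖE h cU x₀ : K} {b : ℕ}

omit [Valued K ℤᵐ⁰] in
/-- **THE GLUE UNIT IS MINUS THE TRACE OF `ŵ`.**  With `cc = ϖE^b`, `Y = dualGen ρ Θ α cc h x₀ = κ·cc(α − ρα)` (`κ = h·x₀Θx₀`), `Θ` an involution fixing `h`, commuting with `ρ`,
`ρϖE = ϖE`, and `ν = (α − ρα)Θ(α − ρα)`, all factors non-zero: `glueUnit ρ Θ α cc h ϖE c_U x₀ b · c_U = −(ŵ + ρŵ)` with `ŵ = (ν·κ)⁻¹` (`Y·ΘY = κ²·ν·P`, `P = (ϖEΘϖE)^b`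
`ρ`-fixed).  So POPULATED (`r ∈ N(E^×)`) reads `ω_σ(−T̂∕h_W) = 1`, `jE T̂ = Tr_ρ ŵ`. [cite: Jacobowitz1962, §4] [cite: Kottwitz1986BaseChangeUnits, §1 pp. 240–241] -/
theorem glueUnit_mul_eq_neg_trace (hΘΘ : ∀ x, Θ (Θ x) = x) (hΘρ : ∀ x, Θ (ρ x) = ρ (Θ x)) (hΘh : Θ h = h) (hρϖ : ρ ϖE = ϖE)
    (hh : h ≠ 0) (hx₀ : x₀ ≠ 0) (hα : α - ρ α ≠ 0) (hϖ0 : ϖE ≠ 0) (hcU : cU ≠ 0) :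
    glueUnit ρ Θ α (ϖE ^ b) h ϖE cU x₀ b * cU =
      -((((α - ρ α) * Θ (α - ρ α)) * (h * (x₀ * Θ x₀)))⁻¹ + ρ (((α - ρ α) * Θ (α - ρ α)) * (h * (x₀ * Θ x₀)))⁻¹) := by
  have hΘx₀ : Θ x₀ ≠ 0 := (map_ne_zero Θ).2 hx₀
  have hΘα : Θ (α - ρ α) ≠ 0 := (map_ne_zero Θ).2 hα
  have hΘϖ : Θ ϖE ≠ 0 := (map_ne_zero Θ).2 hϖ0
  have hρP : ρ ((ϖE * Θ ϖE) ^ b) = (ϖE * Θ ϖE) ^ b := by rw [map_pow, map_mul, hρϖ, ← hΘρ, hρϖ]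
  -- `h x₀Θx₀ / (Y ΘY) = (ν κ)⁻¹ / P`
  have hcore : h * (x₀ * Θ x₀) / (dualGen ρ Θ α (ϖE ^ b) h x₀ * Θ (dualGen ρ Θ α (ϖE ^ b) h x₀)) =
      (((α - ρ α) * Θ (α - ρ α)) * (h * (x₀ * Θ x₀)))⁻¹ / (ϖE * Θ ϖE) ^ b := by
    rw [dualGen_def]
    simp only [map_mul, map_pow, hΘΘ, hΘh]
    field_simp
    ring
  rw [glueUnit_def, hcore, map_div₀, hρP]
  field_simp

end Glue

/-! ## §5 The scalar dictionary: `μ∕D₀ = (μ∕P)·ŵ`, `Tr_ρ(μ∕D₀) = Â·T + B̂·W`, and the sizes of `Â`, `B̂` -/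

section Scalar

variable {ϖE h x₀ μ : K} {b : ℕ}

omit [Valued K ℤᵐ⁰] in
/-- **`μ∕D₀ = (μ∕P)·ŵ`** with `D₀ = cc(α − ρα)·ΘY`, `cc = ϖE^b`, `P = (ϖEΘϖE)^b`, `ŵ = (ν·κ)⁻¹` (letters of `glueUnit_mul_eq_neg_trace`). [cite: Jacobowitz1962, §4] -/
theorem scalar_div_eq_mul_hatw (hΘΘ : ∀ x, Θ (Θ x) = x) (hΘh : Θ h = h) (hh : h ≠ 0) (hx₀ : x₀ ≠ 0) (hα : α - ρ α ≠ 0) (hϖ0 : ϖE ≠ 0) :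
    μ / (ϖE ^ b * (α - ρ α) * Θ (dualGen ρ Θ α (ϖE ^ b) h x₀)) =
      μ / (ϖE * Θ ϖE) ^ b * (((α - ρ α) * Θ (α - ρ α)) * (h * (x₀ * Θ x₀)))⁻¹ := by
  have hΘx₀ : Θ x₀ ≠ 0 := (map_ne_zero Θ).2 hx₀
  have hΘα : Θ (α - ρ α) ≠ 0 := (map_ne_zero Θ).2 hα
  have hΘϖ : Θ ϖE ≠ 0 := (map_ne_zero Θ).2 hϖ0
  rw [dualGen_def]
  simp only [map_mul, map_pow, hΘΘ, hΘh]
  field_simp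
  ring

omit [Valued K ℤᵐ⁰] in
/-- **`Tr_ρ(μ∕D₀) = Â·T + B̂·W`**: with `μ̂ = μ∕P`, `B̂ = (μ̂ − ρμ̂)∕(θ₀ − ρθ₀)`, `Â = μ̂ − B̂θ₀` (`ρ`-fixed, §2) and `T = Tr_ρ ŵ`, `W = Tr_ρ(θ₀ŵ)`:
`μ∕D₀ + ρ(μ∕D₀) = Â·T + B̂·W`. [cite: Jacobowitz1962, §4] [cite: Serre1979, Ch. V §2 Prop. 3] -/
theorem trace_scalar_eq_coords (hρρ : ∀ x, ρ (ρ x) = x) (hΘΘ : ∀ x, Θ (Θ x) = x) (hΘh : Θ h = h) (hh : h ≠ 0) (hx₀ : x₀ ≠ 0) (hα : α - ρ α ≠ 0)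
    (hϖ0 : ϖE ≠ 0) {θ₀ : K} (hθ₀ : ρ θ₀ ≠ θ₀) :
    μ / (ϖE ^ b * (α - ρ α) * Θ (dualGen ρ Θ α (ϖE ^ b) h x₀)) + ρ (μ / (ϖE ^ b * (α - ρ α) * Θ (dualGen ρ Θ α (ϖE ^ b) h x₀))) =
      (μ / (ϖE * Θ ϖE) ^ b - (μ / (ϖE * Θ ϖE) ^ b - ρ (μ / (ϖE * Θ ϖE) ^ b)) / (θ₀ - ρ θ₀) * θ₀) *
          ((((α - ρ α) * Θ (α - ρ α)) * (h * (x₀ * Θ x₀)))⁻¹ + ρ (((α - ρ α) * Θ (α - ρ α)) * (h * (x₀ * Θ x₀)))⁻¹) +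
        (μ / (ϖE * Θ ϖE) ^ b - ρ (μ / (ϖE * Θ ϖE) ^ b)) / (θ₀ - ρ θ₀) *
          (θ₀ * (((α - ρ α) * Θ (α - ρ α)) * (h * (x₀ * Θ x₀)))⁻¹ + ρ (θ₀ * (((α - ρ α) * Θ (α - ρ α)) * (h * (x₀ * Θ x₀)))⁻¹)) := by
  obtain ⟨hρB, hρA⟩ := map_coordAB hρρ hθ₀ (μ / (ϖE * Θ ϖE) ^ b)
  rw [scalar_div_eq_mul_hatw hΘΘ hΘh hh hx₀ hα hϖ0, ← trace_mul_eq_coords hρA hρB]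
  have hδ : θ₀ - ρ θ₀ ≠ 0 := sub_ne_zero.2 (Ne.symm hθ₀)
  have e : μ / (ϖE * Θ ϖE) ^ b - (μ / (ϖE * Θ ϖE) ^ b - ρ (μ / (ϖE * Θ ϖE) ^ b)) / (θ₀ - ρ θ₀) * θ₀ +
      (μ / (ϖE * Θ ϖE) ^ b - ρ (μ / (ϖE * Θ ϖE) ^ b)) / (θ₀ - ρ θ₀) * θ₀ = μ / (ϖE * Θ ϖE) ^ b := by ring
  rw [e]

/-- **THE SIZES OF THE COORDINATES OF THE SCALAR.**  `ρ`, `Θ` isometric, `ρϖE = ϖE`, `|θ₀| ≤ 1`, `|θ₀ − ρθ₀| = 1`; the (R-sp) depth `|μ| = |ϖE|^{2b}` and the EXACT gap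
`|μ − ρμ| = |ϖE|^{2b+2g}·|α − ρα|`, `|α − ρα| = 1`, `1 ≤ g`: with `μ̂ = μ∕(ϖEΘϖE)^b`, `B̂ = (μ̂ − ρμ̂)∕(θ₀ − ρθ₀)`, `Â = μ̂ − B̂θ₀` one has `|μ̂| = 1`, `|B̂| = |ϖE|^{2g}`,
`|Â| = 1`. [cite: Serre1979, Ch. III §6 Prop. 12] [cite: Jacobowitz1962, §4] -/
theorem v_coords_scalar (hΘρ : ∀ x, Θ (ρ x) = ρ (Θ x)) (hvΘ : ∀ x, Valued.v (Θ x) = Valued.v x)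
    (hρϖ : ρ ϖE = ϖE) (hϖE : Valued.v ϖE = exp (-1 : ℤ)) {θ₀ : K} (hθ1 : Valued.v θ₀ ≤ 1) (hθρ : Valued.v (θ₀ - ρ θ₀) = 1)
    (hαρ1 : Valued.v (α - ρ α) = 1) {g : ℕ} (hm : Valued.v μ = Valued.v ϖE ^ (2 * b))
    (hjl : Valued.v (μ - ρ μ) = Valued.v (ϖE ^ (2 * b + 2 * g) * (α - ρ α))) (hg1 : 1 ≤ g) :
    Valued.v (μ / (ϖE * Θ ϖE) ^ b) = 1 ∧ Valued.v ((μ / (ϖE * Θ ϖE) ^ b - ρ (μ / (ϖE * Θ ϖE) ^ b)) / (θ₀ - ρ θ₀)) = Valued.v ϖE ^ (2 * g) ∧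
      Valued.v (μ / (ϖE * Θ ϖE) ^ b - (μ / (ϖE * Θ ϖE) ^ b - ρ (μ / (ϖE * Θ ϖE) ^ b)) / (θ₀ - ρ θ₀) * θ₀) = 1 := by
  have hvϖ0 : Valued.v ϖE ≠ 0 := by rw [hϖE]; exact exp_ne_zero
  have hϖ0 : ϖE ≠ 0 := fun h0 => by rw [h0, map_zero] at hvϖ0; exact hvϖ0 rfl
  have hϖlt : Valued.v ϖE < 1 := by rw [hϖE, ← exp_zero, exp_lt_exp]; norm_num
  have hPv : Valued.v ((ϖE * Θ ϖE) ^ b) = Valued.v ϖE ^ (2 * b) := by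
    rw [Valuation.map_pow, Valuation.map_mul, hvΘ, ← pow_two, ← pow_mul, mul_comm]
  have hP0 : (ϖE * Θ ϖE) ^ b ≠ 0 := pow_ne_zero _ (mul_ne_zero hϖ0 ((map_ne_zero Θ).2 hϖ0))
  have hρP : ρ ((ϖE * Θ ϖE) ^ b) = (ϖE * Θ ϖE) ^ b := by rw [map_pow, map_mul, hρϖ, ← hΘρ, hρϖ]
  have hmuh : Valued.v (μ / (ϖE * Θ ϖE) ^ b) = 1 := by rw [map_div₀, hm, hPv, div_self (pow_ne_zero _ hvϖ0)]
  have hBh : Valued.v ((μ / (ϖE * Θ ϖE) ^ b - ρ (μ / (ϖE * Θ ϖE) ^ b)) / (θ₀ - ρ θ₀)) = Valued.v ϖE ^ (2 * g) := by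
    have e : μ / (ϖE * Θ ϖE) ^ b - ρ (μ / (ϖE * Θ ϖE) ^ b) = (μ - ρ μ) / (ϖE * Θ ϖE) ^ b := by rw [map_div₀, hρP, sub_div]
    rw [map_div₀, hθρ, div_one, e, map_div₀, hjl, Valuation.map_mul, hαρ1, mul_one, Valuation.map_pow, hPv, pow_add,
      mul_div_cancel_left₀ _ (pow_ne_zero _ hvϖ0)]
  refine ⟨hmuh, hBh, ?_⟩
  have hlt : Valued.v ((μ / (ϖE * Θ ϖE) ^ b - ρ (μ / (ϖE * Θ ϖE) ^ b)) / (θ₀ - ρ θ₀) * θ₀) < Valued.v (μ / (ϖE * Θ ϖE) ^ b) := by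
    rw [hmuh, Valuation.map_mul, hBh]
    calc Valued.v ϖE ^ (2 * g) * Valued.v θ₀ ≤ Valued.v ϖE ^ (2 * g) * 1 := by gcongr
      _ < 1 := by rw [mul_one]; exact pow_lt_one₀ zero_le hϖlt (by omega)
  rw [sub_eq_add_neg, Valuation.map_add_eq_of_lt_left _ (by rw [Valuation.map_neg]; exact hlt), hmuh]

end Scalar

end Summit.HodgeConjecture.HodgeConjecture.Cruxes.H413.F0P3cDyRamDiagonalCellCoordinates

end
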